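import Summits.NavierStokesRegularity.NavierStokesRegularity.Theorems.QuietScarPocketDoorZoomLimit
import Summits.NavierStokesRegularity.NavierStokesRegularity.Theorems.QuietScarPocketDoorLPocketDefs
import Literature.Analysis.FluidPDE.PineauVicolOneSliceAssembly

/-!
# QuietScarPocketDoorLZoomLimit — door S31 «QuietScarPocketDoor», §B «L-POCKET SCHEMA» (texts nsreg-p1 g25 `r29/Sketch31D.lean`
# 8bb56c0a84466268, tree `…QuietScarPocketDoorLPocketDefs`), plate (P1) PK1-L, file F3_L: THE CLASS ZOOM AT THE POCKET SCALE
# for an arbitrary continuous linear constraint `L` on velocity gradients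

`exists_lPocket_classZoom L` — F3 (`exists_scarPocket_classZoom`, LEAD ns-s30-p1 g0, `…ZoomLimit`) VERBATIM with the pocket
quantity `‖curl (u t) x‖` replaced by `‖L (fderiv ℝ (u t) x)‖`: if DOOR_L fails at `(C_u, κ)` in the Pineau–Vicol frame, the
pocket-scale zooms of the counterexamples — classical on `Q(0, R_k) ↑ (−∞,0) × ℝ³`, one-point Type I, `𝐈 ≤ I`, with
`‖L (∇ w_k)(s, y)‖ ≤ ε_k` eventually as `s ↑ 0` on `B(e_k, κ)`, `e_k → e` — converge in `L³(Q(0,r))` for every `r` to a Type-I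
ancient mild field `U`, slab suitable with `𝐈 < ⊤`, BACKWARD SINGULAR AT THE ORIGIN (the engine
`LocalTypeIBlowup.exists_typeIAncientMild_zoomLimit_seq` via F2/F2′/F2″ by name).  Only two lines differ from F3: the unpacking
of the negated door and the transport of the pocket quantity under the zoom (`fderiv_nsRescale_eq_smul_stPull` + linearity of
`L` instead of `curl_smul_stPull`).

Width-seat file (prover ns-imp-p1 g4, first plate hand of the S-door lane per DIRECTOR-NS #209 (2); planner of record nsreg-p1 g25),
`--supports stmt-NavierStokesRegularity-0056 --as helper`.  WHAT THIS IS NOT: DOOR_L is a corollary schema of the S31 regularity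
CRITERION about HYPOTHETICAL one-point Type-I blow-up; item 0056 `NoTypeII` and NS regularity are NOT proved and stay OPEN.
-/

noncomputable section

set_option linter.dupNamespace false

namespace Summit.NavierStokesRegularity.NavierStokesRegularity.Theorems.QuietScarPocketDoor

open MeasureTheory Set Function Filter Topology TopologicalSpace Metric
open scoped NNReal ENNReal Topology
open Literature.Analysis Literature.Analysis.FluidPDE

variable {F : Type*} [NormedAddCommGroup F] [NormedSpace ℝ F]

/-- unpacking the failure of DOOR_L at `(C_u, κ)` (F3's `exists_counterexample_of_not_door` with the pocket
quantity `‖L (∇u)‖`): for every `ε > 0` a shell level `C_p` such that at every pocket threshold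
`r₁` some member of the class has an `ε`-quiet pocket below `r₁` and is unbounded near the apex. -/
theorem exists_counterexample_of_not_lDoor (L : (EuclideanSpace ℝ (Fin 3) →L[ℝ] EuclideanSpace ℝ (Fin 3)) →L[ℝ] F) {Cu κ : ℝ} (hdoor : ¬ PVLPocketRegularityAt L Cu κ) {ε : ℝ} (hε : 0 < ε) :
    ∃ Cp : ℝ, 0 < Cp ∧ ∀ r₁ : ℝ, 0 < r₁ →
      ∃ (u : ℝ → EuclideanSpace ℝ (Fin 3) → EuclideanSpace ℝ (Fin 3)) (p : ℝ → EuclideanSpace ℝ (Fin 3) → ℝ),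
        IsClassicalNSSolutionOnRegion (Ico (-1 : ℝ) 0 ×ˢ ball (0 : EuclideanSpace ℝ (Fin 3)) 1) 1 0 u p ∧
        (∀ t ∈ Ico (-1 : ℝ) 0, ∀ x ∈ ball (0 : EuclideanSpace ℝ (Fin 3)) 1, ‖u t x‖ ≤ Cu / (Real.sqrt (-t) + ‖x‖)) ∧
        (∀ t ∈ Ico (-1 : ℝ) 0, ∀ x : EuclideanSpace ℝ (Fin 3), 1 / 2 < ‖x‖ → ‖x‖ < 3 / 4 → |p t x| ≤ Cp) ∧
        (∃ x₁ : EuclideanSpace ℝ (Fin 3), 0 < ‖x₁‖ ∧ ‖x₁‖ ≤ r₁ ∧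
          ∀ x ∈ ball x₁ (κ * ‖x₁‖), ∀ᶠ t in 𝓝[<] (0 : ℝ), ‖x₁‖ ^ 2 * ‖L (fderiv ℝ (u t) x)‖ ≤ ε) ∧
        ¬ ∃ ϱ : ℝ, 0 < ϱ ∧ ∃ B : ℝ, ∀ t : ℝ, -ϱ ^ 2 < t → t < 0 →
          ∀ x ∈ ball (0 : EuclideanSpace ℝ (Fin 3)) ϱ, ‖u t x‖ ≤ B := by
  by_contra hc
  apply hdoor
  refine ⟨ε, hε, fun Cp hCp => ?_⟩
  by_contra hc'
  apply hc
  refine ⟨Cp, hCp, fun r₁ hr₁ => ?_⟩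
  by_contra hc''
  apply hc'
  refine ⟨r₁, hr₁, fun u p hreg hI hP hpk => ?_⟩
  by_contra hbd
  exact hc'' ⟨u, p, hreg, hI, hP, hpk, hbd⟩


/-- **F3_L — THE CLASS ZOOM AT THE POCKET SCALE for the constraint `L`** (F3 `exists_scarPocket_classZoom` verbatim with the
pocket quantity `‖L (∇·)‖`; the zoom transports it by `fderiv_nsRescale_eq_smul_stPull` and the linearity of `L`). -/
theorem exists_lPocket_classZoom (L : (EuclideanSpace ℝ (Fin 3) →L[ℝ] EuclideanSpace ℝ (Fin 3)) →L[ℝ] F) {Cu κ : ℝ} (hdoor : ¬ PVLPocketRegularityAt L Cu κ) :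
    ∃ (w : ℕ → ℝ → EuclideanSpace ℝ (Fin 3) → EuclideanSpace ℝ (Fin 3)) (π : ℕ → ℝ → EuclideanSpace ℝ (Fin 3) → ℝ)
      (Rk : ℕ → ℝ) (ek : ℕ → EuclideanSpace ℝ (Fin 3)) (εk : ℕ → ℝ) (I : ℝ≥0) (e : EuclideanSpace ℝ (Fin 3))
      (U : ℝ → EuclideanSpace ℝ (Fin 3) → EuclideanSpace ℝ (Fin 3)) (P : ℝ → EuclideanSpace ℝ (Fin 3) → ℝ)
      (H : ℝ → EuclideanSpace ℝ (Fin 3) → EuclideanSpace ℝ (Fin 3) →L[ℝ] EuclideanSpace ℝ (Fin 3)),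
      (∀ k, 1 ≤ Rk k) ∧ Tendsto Rk atTop atTop ∧
      (∀ k, IsClassicalNSSolutionOnRegion (parabolicCylinder (Rk k) (0 : ℝ × EuclideanSpace ℝ (Fin 3))) 1 0 (w k) (π k)) ∧
      (∀ k, ∀ z ∈ parabolicCylinder (Rk k) (0 : ℝ × EuclideanSpace ℝ (Fin 3)),
        ‖w k z.1 z.2‖ ≤ Cu / (Real.sqrt (-z.1) + ‖z.2‖)) ∧
      (∀ k, typeIBound (parabolicCylinder (Rk k) (0 : ℝ × EuclideanSpace ℝ (Fin 3))) (w k) (π k)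
        (fun t x => fderiv ℝ (w k t) x) ≤ I) ∧
      (∀ k, ‖ek k‖ = 1) ∧ Tendsto ek atTop (𝓝 e) ∧ ‖e‖ = 1 ∧
      (∀ k, 0 ≤ εk k) ∧ Tendsto εk atTop (𝓝 0) ∧
      (∀ k, ∀ y ∈ ball (ek k) κ, ∀ᶠ s in 𝓝[<] (0 : ℝ), ‖L (fderiv ℝ (w k s) y)‖ ≤ εk k) ∧
      IsTypeIAncientMild Cu U ∧
      IsSuitableWeakSolutionOn (slab (EuclideanSpace ℝ (Fin 3)) (Set.Iio (0 : ℝ)) isOpen_Iio) 1 0 U P ∧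
      HasWeakSpatialGradientOn (slab (EuclideanSpace ℝ (Fin 3)) (Set.Iio (0 : ℝ)) isOpen_Iio) U H ∧
      typeIBound (Iio (0 : ℝ) ×ˢ univ) U P H < ⊤ ∧ IsBackwardSingularPoint U 0 ∧
      (∀ r : ℝ, 0 < r → Tendsto (fun k => eLpNorm (uncurry (w k) - uncurry U) 3
          (volume.restrict (parabolicCylinder r (0 : ℝ × EuclideanSpace ℝ (Fin 3))))) atTop (𝓝 0)) := by
  classical
  -- ## the class radius of F2
  obtain ⟨I, hIall⟩ := exists_pv_typeIBound_le Cu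
  -- ## the counterexamples, level by level
  have hlev : ∀ k : ℕ, ∃ (Cp μ : ℝ) (u : ℝ → EuclideanSpace ℝ (Fin 3) → EuclideanSpace ℝ (Fin 3))
      (p : ℝ → EuclideanSpace ℝ (Fin 3) → ℝ) (x₁ : EuclideanSpace ℝ (Fin 3)),
      0 < μ ∧ μ ≤ 1 / 64 ∧
      IsClassicalNSSolutionOnRegion (Ico (-1 : ℝ) 0 ×ˢ ball (0 : EuclideanSpace ℝ (Fin 3)) 1) 1 0 u p ∧
      (∀ t ∈ Ico (-1 : ℝ) 0, ∀ x ∈ ball (0 : EuclideanSpace ℝ (Fin 3)) 1, ‖u t x‖ ≤ Cu / (Real.sqrt (-t) + ‖x‖)) ∧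
      (∀ t ∈ Ico (-1 : ℝ) 0, ∀ x : EuclideanSpace ℝ (Fin 3), 1 / 2 < ‖x‖ → ‖x‖ < 3 / 4 → |p t x| ≤ Cp) ∧
      typeIBound (parabolicCylinder μ (0 : ℝ × EuclideanSpace ℝ (Fin 3))) u p (fun t x => fderiv ℝ (u t) x) ≤ I ∧
      0 < ‖x₁‖ ∧ ‖x₁‖ ≤ μ / ((k : ℝ) + 2) ∧
      (∀ x ∈ ball x₁ (κ * ‖x₁‖), ∀ᶠ t in 𝓝[<] (0 : ℝ), ‖x₁‖ ^ 2 * ‖L (fderiv ℝ (u t) x)‖ ≤ 1 / ((k : ℝ) + 1)) ∧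
      ¬ ∃ ϱ : ℝ, 0 < ϱ ∧ ∃ B : ℝ, ∀ t : ℝ, -ϱ ^ 2 < t → t < 0 →
          ∀ x ∈ ball (0 : EuclideanSpace ℝ (Fin 3)) ϱ, ‖u t x‖ ≤ B := by
    intro k
    obtain ⟨Cp, hCp, hr⟩ := exists_counterexample_of_not_lDoor L hdoor (by positivity : (0 : ℝ) < 1 / ((k : ℝ) + 1))
    obtain ⟨μ, hμ, hμ64, hμI⟩ := hIall Cp
    obtain ⟨u, p, hreg, hI, hP, ⟨x₁, hx₁, hx₁r, hpk⟩, hbd⟩ := hr (μ / ((k : ℝ) + 2)) (by positivity)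
    exact ⟨Cp, μ, u, p, x₁, hμ, hμ64, hreg, hI, hP, hμI u p hreg hI hP, hx₁, hx₁r, hpk, hbd⟩
  choose Cp μ u p x₁ hμ hμ64 hreg hI hP hIμ hx₁ hx₁μ hpk hbd using hlev
  -- ## scales
  set lam : ℕ → ℝ := fun k => ‖x₁ k‖ with hlam_def
  have hlam : ∀ k, 0 < lam k := hx₁
  have hμ1 : ∀ k, μ k ≤ 1 := fun k => (hμ64 k).trans (by norm_num)
  have hlamμ : ∀ k, lam k * ((k : ℝ) + 2) ≤ μ k := fun k => by
    have h := hx₁μ k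
    rwa [le_div_iff₀ (by positivity)] at h
  -- ## directions: a convergent subsequence on the unit sphere
  set e' : ℕ → EuclideanSpace ℝ (Fin 3) := fun k => (lam k)⁻¹ • x₁ k with he'_def
  have he'1 : ∀ k, ‖e' k‖ = 1 := fun k => by
    rw [he'_def]; dsimp only
    rw [norm_smul, norm_inv, Real.norm_of_nonneg (hlam k).le, hlam_def, inv_mul_cancel₀ (hx₁ k).ne']
  obtain ⟨e, he, φ₀, hφ₀, hφ₀e⟩ := (isCompact_sphere (0 : EuclideanSpace ℝ (Fin 3)) 1).tendsto_subseq
    (fun k => show e' k ∈ sphere (0 : EuclideanSpace ℝ (Fin 3)) 1 by rw [mem_sphere_zero_iff_norm]; exact he'1 k)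
  rw [mem_sphere_zero_iff_norm] at he
  -- ## the engine's sequence: the `μ`-zooms along `φ₀`, scales `R = λ/μ`
  set v : ℕ → ℝ → EuclideanSpace ℝ (Fin 3) → EuclideanSpace ℝ (Fin 3) := fun n => nsRescale (μ (φ₀ n)) (u (φ₀ n)) with hv_def
  set q : ℕ → ℝ → EuclideanSpace ℝ (Fin 3) → ℝ := fun n => nsRescalePressure (μ (φ₀ n)) (p (φ₀ n)) with hq_def
  set R : ℕ → ℝ := fun n => lam (φ₀ n) / μ (φ₀ n) with hR_def
  have hRpos : ∀ n, 0 < R n := fun n => div_pos (hlam _) (hμ _)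
  have hRle : ∀ n, R n ≤ 1 / ((n : ℝ) + 2) := by
    intro n
    rw [hR_def]; dsimp only
    rw [div_le_div_iff₀ (hμ _) (by positivity), one_mul]
    have hn : ((n : ℝ) + 2) ≤ ((φ₀ n : ℕ) : ℝ) + 2 := by
      have := hφ₀.id_le n; exact_mod_cast Nat.add_le_add_right this 2
    calc lam (φ₀ n) * ((n : ℝ) + 2) ≤ lam (φ₀ n) * (((φ₀ n : ℕ) : ℝ) + 2) :=
          mul_le_mul_of_nonneg_left hn (hlam _).le
      _ ≤ μ (φ₀ n) := hlamμ _
  have hR0 : Tendsto R atTop (𝓝 0) := by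
    have h2 : Tendsto (fun n : ℕ => 1 / ((n : ℝ) + 2)) atTop (𝓝 0) := by
      have h := tendsto_one_div_add_atTop_nhds_zero_nat (𝕜 := ℝ)
      have h' : Tendsto (fun n : ℕ => n + 1) atTop atTop := tendsto_add_atTop_nat 1
      have := h.comp h'
      refine this.congr fun n => ?_
      simp only [Function.comp, Nat.cast_add, Nat.cast_one]
      ring_nf
    exact squeeze_zero (fun n => (hRpos n).le) hRle h2
  have hdata := fun n => pv_zoom_ballData (hreg (φ₀ n)) (hI (φ₀ n)) (hP (φ₀ n)) (hμ (φ₀ n)) (hμ64 (φ₀ n)) (hIμ (φ₀ n))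
  have hcontu : ∀ k, ContinuousOn (uncurry (u k)) (Ioo (-1 : ℝ) 0 ×ˢ ball (0 : EuclideanSpace ℝ (Fin 3)) 1) := fun k =>
    (hreg k).smooth_velocity.continuousOn.mono (prod_mono Ioo_subset_Ico_self Subset.rfl)
  obtain ⟨φ, hφ, U, P, H, hmild, hsw, hwg, hIU, hsing, hL3, -, -⟩ :=
    LocalTypeIBlowup.exists_typeIAncientMild_zoomLimit_seq (u := v) (p := q)
      (G := fun n t x => fderiv ℝ (v n t) x) (z₀ := fun _ => (0 : ℝ × EuclideanSpace ℝ (Fin 3))) (M := Cu)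
      one_pos (I := (I : ℝ≥0∞)) ENNReal.coe_lt_top
      (fun n => (hdata n).1) (fun n => (hdata n).2.1) (fun n => (hdata n).2.2.1) (fun n => (hdata n).2.2.2.1)
      (fun n t x htx => (hdata n).2.2.2.2 t x htx)
      (fun n => isBackwardSingularPoint_nsRescale_of_not_bounded (hμ (φ₀ n)) (hcontu (φ₀ n)) (hbd (φ₀ n)))
      hRpos hR0
  -- ## the outputs along `k_j = φ₀ (φ j)`
  set kk : ℕ → ℕ := fun j => φ₀ (φ j) with hkk_def
  have hkk : StrictMono kk := hφ₀.comp hφ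
  set Λ : ℕ → ℝ := fun j => lam (kk j) with hΛ_def
  have hΛ : ∀ j, 0 < Λ j := fun j => hlam _
  -- identification of the engine's zoom with the pocket-scale zoom
  have hRL : ∀ j, R (φ j) * μ (kk j) = Λ j := fun j => div_mul_cancel₀ _ (hμ _).ne'
  have hzoom : ∀ j, R (φ j) • stPull (R (φ j) ^ 2) (R (φ j)) ((fun _ : ℕ => (0 : ℝ × EuclideanSpace ℝ (Fin 3))) (φ j)).1
      ((fun _ : ℕ => (0 : ℝ × EuclideanSpace ℝ (Fin 3))) (φ j)).2 (v (φ j)) = nsRescale (Λ j) (u (kk j)) := by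
    intro j
    simp only [Prod.fst_zero, Prod.snd_zero]
    rw [hv_def]; dsimp only
    rw [nsRescale_eq_smul_stPull, nsRescale_eq_smul_stPull, zoom_zoom, hRL]
  refine ⟨fun j => nsRescale (Λ j) (u (kk j)), fun j => nsRescalePressure (Λ j) (p (kk j)), fun j => μ (kk j) / Λ j,
    fun j => (Λ j)⁻¹ • x₁ (kk j), fun j => 1 / (((kk j : ℕ) : ℝ) + 1), I, e, U, P, H, ?_, ?_, ?_, ?_, ?_, ?_, ?_, he, ?_, ?_,
    ?_, hmild, hsw, hwg, hIU, hsing, ?_⟩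
  · -- `1 ≤ μ/λ`
    intro j
    dsimp only
    rw [le_div_iff₀ (hΛ j), one_mul]
    have h := hlamμ (kk j)
    have hk0 : (0 : ℝ) ≤ ((kk j : ℕ) : ℝ) := Nat.cast_nonneg _
    have hLj : Λ j = lam (kk j) := rfl
    rw [hLj]
    nlinarith [hlam (kk j)]
  · -- `μ/λ → ∞`
    have h1 : Tendsto (fun j => ((kk j : ℕ) : ℝ) + 2) atTop atTop :=
      tendsto_atTop_add_const_right _ _ (tendsto_natCast_atTop_atTop.comp hkk.tendsto_atTop)
    refine tendsto_atTop_mono (fun j => ?_) h1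
    rw [le_div_iff₀ (hΛ j)]
    have h := hlamμ (kk j)
    have hLj : Λ j = lam (kk j) := rfl
    rw [hLj, mul_comm]
    exact h
  · intro j
    dsimp only
    exact isClassical_nsRescale_cylinder (hreg _) (hμ _) (hμ1 _) (hΛ j)
  · intro j z hz
    dsimp only at hz ⊢
    exact norm_nsRescale_le_of_typeI_cylinder (hI _) (hμ1 _) (hΛ j) hz
  · -- transport of `𝐈`
    intro j
    dsimp only
    have h := typeIBound_nsZoom (hΛ j) (0 : ℝ × EuclideanSpace ℝ (Fin 3)).1 (0 : ℝ × EuclideanSpace ℝ (Fin 3)).2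
      (parabolicCylinder (μ (kk j)) (0 : ℝ × EuclideanSpace ℝ (Fin 3))) (u (kk j)) (p (kk j))
      (fun t x => fderiv ℝ (u (kk j) t) x)
    rw [zoom_preimage_parabolicCylinder (hΛ j)] at h
    simp only [Prod.fst_zero, Prod.snd_zero] at h
    rw [fderiv_nsRescale_eq_smul_stPull, nsRescale_eq_smul_stPull, nsRescalePressure_eq_smul_stPull_zero, h]
    exact hIμ _
  · intro j
    dsimp only
    rw [norm_smul, norm_inv, Real.norm_of_nonneg (hΛ j).le]
    exact inv_mul_cancel₀ (hΛ j).ne'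
  · exact hφ₀e.comp hφ.tendsto_atTop
  · intro j
    dsimp only
    positivity
  · have h := tendsto_one_div_add_atTop_nhds_zero_nat (𝕜 := ℝ)
    exact h.comp hkk.tendsto_atTop
  · -- the pocket at the zoomed scale
    intro j y hy
    dsimp only at hy ⊢
    have hxmem : Λ j • y ∈ ball (x₁ (kk j)) (κ * ‖x₁ (kk j)‖) := by
      rw [mem_ball, dist_eq_norm]
      have : Λ j • y - x₁ (kk j) = Λ j • (y - (Λ j)⁻¹ • x₁ (kk j)) := by
        rw [smul_sub, smul_inv_smul₀ (hΛ j).ne']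
      rw [this, norm_smul, Real.norm_of_nonneg (hΛ j).le]
      rw [mem_ball, dist_eq_norm] at hy
      have := mul_lt_mul_of_pos_left hy (hΛ j)
      simpa [hΛ_def, hlam_def, mul_comm] using this
    have hev := hpk (kk j) (Λ j • y) hxmem
    have hT : Tendsto (fun s : ℝ => (0 : ℝ) + Λ j ^ 2 * s) (𝓝[<] (0 : ℝ)) (𝓝[<] (0 : ℝ)) :=
      tendsto_time_affine_nhdsLT (pow_pos (hΛ j) 2)
    filter_upwards [hT.eventually hev] with s hs
    have e := congrFun (congrFun (fderiv_nsRescale_eq_smul_stPull (Λ j) (u (kk j))) s) y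
    simp only [Pi.smul_apply, stPull_apply, zero_add] at e
    rw [e, map_smul, norm_smul, Real.norm_of_nonneg (by positivity),
      show Λ j ^ 2 = ‖x₁ (kk j)‖ ^ 2 by rw [hΛ_def, hlam_def]]
    simpa only [zero_add] using hs
  · intro r hr
    have h := hL3 r hr
    simp only [hzoom] at h
    dsimp only
    exact h


end Summit.NavierStokesRegularity.NavierStokesRegularity.Theorems.QuietScarPocketDoor

end
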